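import Literature.Geometry.Symplectic.PALFRadialFlowout
import Literature.Geometry.Symplectic.PALFFibreTransport
import HarnessLib

/-!
# The regular fibres of a Lefschetz fibration with planar boundary open book are planar

Topic `Literature/Geometry/Symplectic` (fact seat
`provefact-Literature.Geometry.Symplectic.Oba2016_s-add47373d4`; brick `W7a-B3` of the fibre-page statement `hF`
of `kasHandleCount_of_planarFibreMorse`, Kas 1980 §2 / Gompf–Stipsicz 1999 §8.2: "the regular
fibre is the page").  For a PALF `f : W → 𝔻²` whose boundary open book is planar, the interior
`F°(c)` of every regular fibre over the open disc admits a continuous injection into the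
`2`-sphere.  The fibre over a point `ρ₁ e` close to the boundary circle is pushed into the page
over `e` by the retraction of the angle-preserving flow-out data of
`PALF.exists_flowoutInput_angleForm_eq_zero`: along the backward flow-out `f` stays on the ray
`ℝ₊ e` and `‖f‖` increases (`PALF.exists_lt_one_forall_inner_mfderiv_neg`), so the retraction
lands in the page over `e` and is injective; any other regular fibre is homeomorphic to this one
(`PALF.nonempty_homeomorph_regularFibreOn`).

* `Icc_subset_of_forall_mem_nhdsLT` — leftward real induction;
* `PALF.exists_lt_one_forall_flowout_lt`, `PALF.exists_regular_smul_mem_Ioo`,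
  `FlowoutInput.Cover.Fl_ret_eq` — preliminaries;
* `PALF.forall_angleForm_eq_zero_and_le_inner_Fl` — **the ray invariant** along the backward
  flow-out;
* `PALF.exists_continuous_injective_regularFibreOn_page` — a continuous injection of `F°(ρ₁ e)`
  into the page over `e`;
* `PALF.exists_continuous_injective_regularFibreOn_sphere` — **planar pages ⇒ planar regular
  fibres**.

Everything is proved; no definitions, no named facts.

## References

* A. Kas, *On the handlebody decomposition associated to a Lefschetz fibration*, Pacific J.
  Math. 89 (1980), §2. [Kas1980]
* R. E. Gompf, A. I. Stipsicz, *4-manifolds and Kirby calculus*, GSM 20 (1999), §8.2.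
  [GompfStipsiczGSM1999]
-/

open scoped Manifold ContDiff Topology RealInnerProductSpace
open Set Function Filter Metric

noncomputable section

namespace Literature.Geometry.Symplectic

open Literature.Topology.FourManifolds

universe u

/-! ### §1 Preliminaries -/

/-- **Leftward real induction**: a set closed in `[a, b]`, containing `b`, which is a left
neighbourhood of each of its points in `(a, b]`, contains `[a, b]` (the rightward version
`IsClosed.Icc_subset_of_forall_mem_nhdsWithin` applied to `-S`). [folklore] -/
theorem Icc_subset_of_forall_mem_nhdsLT {a b : ℝ} {S : Set ℝ} (hS : IsClosed (S ∩ Icc a b))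
    (hb : b ∈ S) (hlt : ∀ t ∈ S ∩ Ioc a b, S ∈ 𝓝[<] t) : Icc a b ⊆ S := by
  set S' : Set ℝ := Neg.neg ⁻¹' S with hS'
  have h1 : IsClosed (S' ∩ Icc (-b) (-a)) := by
    have : S' ∩ Icc (-b) (-a) = Neg.neg ⁻¹' (S ∩ Icc a b) := by
      ext t
      simp only [hS', mem_inter_iff, mem_preimage, mem_Icc]
      constructor
      · rintro ⟨h, h1, h2⟩; exact ⟨h, by linarith, by linarith⟩
      · rintro ⟨h, h1, h2⟩; exact ⟨h, by linarith, by linarith⟩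
    rw [this]
    exact hS.preimage continuous_neg
  have h2 : -b ∈ S' := by show -(-b) ∈ S; rw [neg_neg]; exact hb
  have h3 : ∀ s ∈ S' ∩ Ico (-b) (-a), S' ∈ 𝓝[>] s := by
    rintro s ⟨hs, hs1, hs2⟩
    have h := hlt (-s) ⟨hs, by linarith, by linarith⟩
    exact tendsto_neg_nhdsGT h
  have h4 := h1.Icc_subset_of_forall_mem_nhdsWithin h2 h3
  intro t ht
  have : -t ∈ S' := h4 ⟨by linarith [ht.2], by linarith [ht.1]⟩
  show t ∈ S
  have h5 : -(-t) ∈ S := this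
  rwa [neg_neg] at h5

variable {W : Type u} [TopologicalSpace W] [ChartedSpace (EuclideanHalfSpace 4) W]
  [IsManifold (𝓡∂ 4) ∞ W] [T2Space W] [CompactSpace W]
  {o : SmoothOrientation (𝓡∂ 4) W} {b : BoundaryData (𝓡∂ 4) W (𝓡 3)}

namespace PALF

omit [T2Space W] in
/-- Points with `‖f‖` close to `1` have small collar coordinate: for `s > 0` there is `ρ♮ < 1`
with `σ x < s` whenever `‖f x‖ ≥ ρ♮` (on the compact `{σ ≥ s}` one has `‖f‖ < 1`). [folklore] -/
theorem exists_lt_one_forall_flowout_lt (P : PALF o b) (D : FlowoutInput 3 W) {s : ℝ} (hs : 0 < s) :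
    ∃ ρ' : ℝ, ρ' < 1 ∧ ∀ x, ρ' ≤ ‖P.f x‖ → D.f x < s := by
  set K : Set W := {x | s ≤ D.f x} with hK
  have hKc : IsCompact K := (isClosed_le continuous_const D.f_smooth.continuous).isCompact
  have hKlt : ∀ x ∈ K, ‖P.f x‖ < 1 := by
    intro x hx
    rcases (P.norm_apply_le_one x).lt_or_eq with h | h
    · exact h
    · exfalso
      have hxb := P.mem_boundary_of_norm_eq_one h
      have h0 : D.f x = 0 := (D.f_eq_zero_iff x).2 hxb
      have h1 : s ≤ D.f x := hx
      linarith
  by_cases hne : K.Nonempty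
  · obtain ⟨x₀, hx₀, hmax⟩ :=
      hKc.exists_isMaxOn hne (continuous_norm.comp P.contMDiff.continuous).continuousOn
    refine ⟨(‖P.f x₀‖ + 1) / 2, by linarith [hKlt x₀ hx₀], fun x hx => ?_⟩
    by_contra h
    push Not at h
    have h3 : ‖P.f x‖ ≤ ‖P.f x₀‖ := isMaxOn_iff.1 hmax x h
    linarith [hKlt x₀ hx₀]
  · refine ⟨0, one_pos, fun x _ => ?_⟩
    by_contra h
    push Not at h
    exact hne ⟨x, h⟩

omit [T2Space W] [CompactSpace W] in
/-- On every ray there are regular values arbitrarily close to the boundary circle (the critical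
values are finitely many). [folklore] -/
theorem exists_regular_smul_mem_Ioo (P : PALF o b) {e : EuclideanSpace ℝ (Fin 2)} (he : ‖e‖ = 1)
    {ρ₀ : ℝ} (hρ₀ : ρ₀ < 1) :
    ∃ ρ₁ : ℝ, ρ₀ < ρ₁ ∧ ρ₁ < 1 ∧ ρ₁ • e ∉ P.f '' ↑P.crit := by
  have hinj : Injective fun ρ : ℝ => ρ • e := by
    intro r r' h
    have h' : (r - r') • e = 0 := by rw [sub_smul]; exact sub_eq_zero.2 h
    rcases smul_eq_zero.1 h' with h1 | h1
    · linarith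
    · exfalso; rw [h1, norm_zero] at he; exact zero_ne_one he
  have hfin : ((fun ρ : ℝ => ρ • e) ⁻¹' (P.f '' ↑P.crit)).Finite :=
    (P.crit.finite_toSet.image P.f).preimage hinj.injOn
  obtain ⟨ρ₁, hρ₁, hρ₁n⟩ := ((Ioo_infinite hρ₀).sdiff hfin).nonempty
  exact ⟨ρ₁, hρ₁.1, hρ₁.2, hρ₁n⟩

end PALF

omit [CompactSpace W] in
/-- **The flow-out from the retraction point runs through the flow line**: for `σ z ≤ a` and
`u ∈ [0, σ z]`, `Fl (ret z) u = Fl z (u - σ z)` (forward uniqueness; the endpoint case is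
`FlowoutInput.Cover.Fl_ret`). [folklore] -/
theorem _root_.Literature.Topology.FourManifolds.FlowoutInput.Cover.Fl_ret_eq
    {D : FlowoutInput 3 W} (Γ : D.Cover) {z : W} (hz : D.f z ≤ Γ.a) {u : ℝ}
    (hu : u ∈ Icc 0 (D.f z)) : Γ.Fl (Γ.ret z) u = Γ.Fl z (u - D.f z) := by
  set w := Γ.ret z with hw
  have hfw : D.f w = 0 := Γ.f_ret hz
  have hwa : D.f w ≤ Γ.a := by rw [hfw]; exact Γ.a_pos.le
  have h1 : IsMIntegralCurveOn (Γ.Fl w) D.ξ (Icc 0 (D.f z)) := by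
    have h := Γ.isMIntegralCurveOn_Fl hwa
    rw [hfw, neg_zero] at h
    exact h.mono (Icc_subset_Icc le_rfl hz)
  have h2 : IsMIntegralCurveOn (Γ.Fl z ∘ (· + -D.f z)) D.ξ (Icc 0 (D.f z)) := by
    refine ((Γ.isMIntegralCurveOn_Fl hz).comp_add (-D.f z)).mono fun t ht => ?_
    show t + -D.f z ∈ Icc (-D.f z) Γ.a
    constructor <;> linarith [ht.1, ht.2, hz]
  have h0 : Γ.Fl w 0 = (Γ.Fl z ∘ (· + -D.f z)) 0 := by
    rw [Γ.Fl_zero hwa]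
    show w = Γ.Fl z (0 + -D.f z)
    rw [zero_add, hw]
    rfl
  have h := D.eqOn_of_eq_left h1 h2 h0 hu
  rw [h]
  show Γ.Fl z (u + -D.f z) = Γ.Fl z (u - D.f z)
  rw [← sub_eq_add_neg]

namespace PALF

/-! ### §2 The ray invariant along the backward flow-out -/

omit [T2Space W] [CompactSpace W] in
/-- **The ray invariant.**  Let `D″` be flow-out data whose field preserves the `e`-angle of `f`
on the slab `{σ ≤ s₀, ⟪e, f⟫ ≥ ρ, |dφ_e(f)| ≤ w₀}` and decreases `‖f‖` where `‖f‖ ≥ ρ″`, and let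
`x` lie over the ray point `ρ₁ e`, `ρ₁ > max(ρ, ρ″)`, `ρ > 0`, with `σ x ≤ min(s₀, a)`.  Then along
the backward flow-out `t ↦ Fl x t`, `t ∈ [-σ x, 0]`, `f` stays on the ray: `dφ_e(f) = 0` and
`⟪e, f⟫ ≥ ρ₁` (leftward real induction: near a time where the invariant holds the point is in the
slab, so `dφ_e(f)` is locally constant, `f = ⟪e, f⟫ e`, and `d⟪e, f⟫/dt = ⟪f, df(ξ″)⟫/⟪e, f⟫ < 0`).
[cite: Kas1980, §2] -/
theorem forall_angleForm_eq_zero_and_le_inner_Fl (P : PALF o b) {D'' : FlowoutInput 3 W}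
    (Γ : D''.Cover) {e : EuclideanSpace ℝ (Fin 2)} (he : ‖e‖ = 1) {ρ s₀ w₀ ρ'' ρ₁ : ℝ}
    (hρ : 0 < ρ) (hw₀ : 0 < w₀) (hρρ₁ : ρ < ρ₁) (hρ''ρ₁ : ρ'' < ρ₁)
    (hang : ∀ x, D''.f x ≤ s₀ → ρ ≤ ⟪e, P.f x⟫ → |angleForm e (P.f x)| ≤ w₀ →
      angleForm e (mfderiv (𝓡∂ 4) 𝓘(ℝ, EuclideanSpace ℝ (Fin 2)) P.f x (D''.ξ x)) = 0)
    (hrad : ∀ x, ρ'' ≤ ‖P.f x‖ →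
      ⟪P.f x, mfderiv (𝓡∂ 4) 𝓘(ℝ, EuclideanSpace ℝ (Fin 2)) P.f x (D''.ξ x)⟫ < 0)
    {x : W} (hxs : D''.f x ≤ s₀) (hxa : D''.f x ≤ Γ.a) (hfx : P.f x = ρ₁ • e) :
    ∀ t ∈ Icc (-D''.f x) 0,
      angleForm e (P.f (Γ.Fl x t)) = 0 ∧ ρ₁ ≤ ⟪e, P.f (Γ.Fl x t)⟫ := by
  set γ : ℝ → W := Γ.Fl x with hγdef
  set J : Set ℝ := Icc (-D''.f x) Γ.a with hJ
  have hγ : IsMIntegralCurveOn γ D''.ξ J := Γ.isMIntegralCurveOn_Fl hxa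
  set A : ℝ → ℝ := fun t => angleForm e (P.f (γ t)) with hA
  set R : ℝ → ℝ := fun t => ⟪e, P.f (γ t)⟫ with hR
  -- derivatives within `J`
  have hfd : ∀ t ∈ J, HasDerivWithinAt (fun t => P.f (γ t))
      (mfderiv (𝓡∂ 4) 𝓘(ℝ, EuclideanSpace ℝ (Fin 2)) P.f (γ t) (D''.ξ (γ t))) J t :=
    fun t ht => hasDerivWithinAt_comp_of_isMIntegralCurveOn P.contMDiff hγ ht
  have hAd : ∀ t ∈ J, HasDerivWithinAt A
      (angleForm e (mfderiv (𝓡∂ 4) 𝓘(ℝ, EuclideanSpace ℝ (Fin 2)) P.f (γ t) (D''.ξ (γ t)))) J t :=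
    fun t ht => (angleForm e).hasFDerivAt.comp_hasDerivWithinAt t (hfd t ht)
  have hRd : ∀ t ∈ J, HasDerivWithinAt R
      ⟪e, mfderiv (𝓡∂ 4) 𝓘(ℝ, EuclideanSpace ℝ (Fin 2)) P.f (γ t) (D''.ξ (γ t))⟫ J t := by
    intro t ht
    have h := (hasDerivWithinAt_const t J e).inner ℝ (hfd t ht)
    simpa using h
  have hAc : ContinuousOn A J := fun t ht => (hAd t ht).continuousWithinAt
  have hRc : ContinuousOn R J := fun t ht => (hRd t ht).continuousWithinAt
  -- the collar coordinate along the backward flow-out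
  have hσ : ∀ t ∈ J, t ≤ 0 → D''.f (γ t) ≤ s₀ := by
    intro t ht ht0
    show D''.f (Γ.Fl x t) ≤ s₀
    rw [Γ.f_Fl hxa ht]; linarith
  have hJ0 : Icc (-D''.f x) 0 ⊆ J := Icc_subset_Icc le_rfl Γ.a_pos.le
  -- leftward induction
  set S : Set ℝ := {t | A t = 0 ∧ ρ₁ ≤ R t} with hS
  have hclosed : IsClosed (S ∩ Icc (-D''.f x) 0) := by
    have h1 : S ∩ Icc (-D''.f x) 0 =
        (Icc (-D''.f x) 0 ∩ A ⁻¹' {0}) ∩ (Icc (-D''.f x) 0 ∩ R ⁻¹' Ici ρ₁) := by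
      ext t
      simp only [hS, mem_inter_iff, mem_setOf_eq, mem_preimage, mem_singleton_iff, mem_Ici]
      tauto
    rw [h1]
    exact ((hAc.mono hJ0).preimage_isClosed_of_isClosed isClosed_Icc isClosed_singleton).inter
      ((hRc.mono hJ0).preimage_isClosed_of_isClosed isClosed_Icc isClosed_Ici)
  have hee : angleForm e e = 0 := by simp only [angleForm_apply]; ring
  have hinner : ⟪e, e⟫ = 1 := by rw [real_inner_self_eq_norm_sq, he, one_pow]
  have h0S : (0 : ℝ) ∈ S := by
    constructor
    · show angleForm e (P.f (Γ.Fl x 0)) = 0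
      rw [Γ.Fl_zero hxa, hfx, map_smul, hee, smul_zero]
    · show ρ₁ ≤ ⟪e, P.f (Γ.Fl x 0)⟫
      rw [Γ.Fl_zero hxa, hfx, real_inner_smul_right, hinner, mul_one]
  have hstep : ∀ t₀ ∈ S ∩ Ioc (-D''.f x) 0, S ∈ 𝓝[<] t₀ := by
    rintro t₀ ⟨⟨hA0, hR0⟩, ht₀lo, ht₀0⟩
    have ht₀J : t₀ ∈ J := hJ0 ⟨ht₀lo.le, ht₀0⟩
    set m : ℝ := max ρ ρ'' with hm
    have hmρ₁ : m < ρ₁ := max_lt hρρ₁ hρ''ρ₁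
    -- near `t₀` within `J`: `|A| < w₀` and `R > m`
    have hA_ev : ∀ᶠ t in 𝓝[J] t₀, |A t| < w₀ :=
      (continuous_abs.continuousAt.comp_continuousWithinAt (hAc t₀ ht₀J)).eventually
        (gt_mem_nhds (by show |A t₀| < w₀; rw [hA0, abs_zero]; exact hw₀))
    have hR_ev : ∀ᶠ t in 𝓝[J] t₀, m < R t :=
      (hRc t₀ ht₀J).eventually (lt_mem_nhds (lt_of_lt_of_le hmρ₁ hR0))
    obtain ⟨δ, hδ, hball⟩ := Metric.mem_nhdsWithin_iff.1 (hA_ev.and hR_ev)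
    -- the convex time set `N`
    set N : Set ℝ := Icc (-D''.f x) 0 ∩ ball t₀ δ with hN
    have hNJ : N ⊆ J := fun t ht => hJ0 ht.1
    have hNconv : Convex ℝ N := (convex_Icc _ _).inter (convex_ball t₀ δ)
    have ht₀N : t₀ ∈ N := ⟨⟨ht₀lo.le, ht₀0⟩, mem_ball_self hδ⟩
    have hNgood : ∀ t ∈ N, |A t| < w₀ ∧ m < R t := fun t ht => hball ⟨ht.2, hNJ ht⟩
    -- `A` is constant `= 0` on `N`
    have hAN : ∀ t ∈ N, A t = 0 := by
      have hderiv : ∀ t ∈ N, HasFDerivWithinAt A (0 : ℝ →L[ℝ] ℝ) N t := by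
        intro t ht
        have h1 := hAd t (hNJ ht)
        have h2 : angleForm e (mfderiv (𝓡∂ 4) 𝓘(ℝ, EuclideanSpace ℝ (Fin 2)) P.f (γ t)
            (D''.ξ (γ t))) = 0 :=
          hang (γ t) (hσ t (hNJ ht) ht.1.2) ((le_max_left _ _).trans (hNgood t ht).2.le)
            (hNgood t ht).1.le
        rw [h2] at h1
        simpa using (h1.mono hNJ).hasFDerivWithinAt
      have hbound : ∀ s ∈ N, ‖(0 : ℝ →L[ℝ] ℝ)‖ ≤ 0 := fun _ _ => by simp
      intro t ht
      have h := hNconv.norm_image_sub_le_of_norm_hasFDerivWithin_le hderiv hbound ht₀N ht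
      rw [zero_mul, norm_le_zero_iff, sub_eq_zero] at h
      rw [h, hA0]
    -- on `N`, `f = R e` and `R` decreases
    have hRneg : ∀ t ∈ N,
        ⟪e, mfderiv (𝓡∂ 4) 𝓘(ℝ, EuclideanSpace ℝ (Fin 2)) P.f (γ t) (D''.ξ (γ t))⟫ < 0 := by
      intro t ht
      have hq : P.f (γ t) = R t • e := eq_inner_smul_of_angleForm_eq_zero he (hAN t ht)
      have hRpos : 0 < R t := lt_of_le_of_lt (hρ.le.trans (le_max_left _ _)) (hNgood t ht).2
      have hnorm : ρ'' ≤ ‖P.f (γ t)‖ := by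
        rw [hq, norm_smul, he, mul_one, Real.norm_eq_abs]
        exact ((le_max_right _ _).trans (hNgood t ht).2.le).trans (le_abs_self _)
      have h := hrad (γ t) hnorm
      rw [hq, real_inner_smul_left] at h
      rcases mul_neg_iff.1 h with h1 | h1
      · exact h1.2
      · exact absurd h1.1 (not_lt.2 hRpos.le)
    have hRanti : AntitoneOn R N :=
      antitoneOn_of_hasDerivWithinAt_nonpos hNconv (hRc.mono hNJ)
        (fun t ht => (hRd t (hNJ (interior_subset ht))).mono (interior_subset.trans hNJ))
        fun t ht => (hRneg t (interior_subset ht)).le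
    -- a left neighbourhood of `t₀` inside `S`
    set δ₁ : ℝ := min δ (t₀ + D''.f x) with hδ₁
    have hδ₁pos : 0 < δ₁ := lt_min hδ (by linarith)
    have hsub : Ioo (t₀ - δ₁) t₀ ⊆ S := by
      intro t ht
      have h1 : δ₁ ≤ δ := min_le_left _ _
      have h2 : δ₁ ≤ t₀ + D''.f x := min_le_right _ _
      have htN : t ∈ N := by
        refine ⟨⟨by linarith [ht.1], by linarith [ht.2]⟩, ?_⟩
        rw [mem_ball, Real.dist_eq, abs_lt]
        constructor <;> linarith [ht.1, ht.2]
      exact ⟨hAN t htN, hR0.trans (hRanti htN ht₀N ht.2.le)⟩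
    exact mem_of_superset (Ioo_mem_nhdsLT (by linarith)) hsub
  intro t ht
  exact Icc_subset_of_forall_mem_nhdsLT hclosed h0S hstep ht

/-! ### §3 The retraction of the fibre over a ray point into the page over the ray -/

section Retraction

variable (P : PALF o b) {D'' : FlowoutInput 3 W} (Γ : D''.Cover) {e : EuclideanSpace ℝ (Fin 2)}
  (he : ‖e‖ = 1) {ρ s₀ w₀ ρ'' ρ₁ : ℝ} (hρ : 0 < ρ) (hw₀ : 0 < w₀) (hρρ₁ : ρ < ρ₁) (hρ''ρ₁ : ρ'' < ρ₁)
  (hang : ∀ x, D''.f x ≤ s₀ → ρ ≤ ⟪e, P.f x⟫ → |angleForm e (P.f x)| ≤ w₀ →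
    angleForm e (mfderiv (𝓡∂ 4) 𝓘(ℝ, EuclideanSpace ℝ (Fin 2)) P.f x (D''.ξ x)) = 0)
  (hrad : ∀ x, ρ'' ≤ ‖P.f x‖ →
    ⟪P.f x, mfderiv (𝓡∂ 4) 𝓘(ℝ, EuclideanSpace ℝ (Fin 2)) P.f x (D''.ξ x)⟫ < 0)

include he hρ hw₀ hρρ₁ hρ''ρ₁ hang hrad

omit [T2Space W] [CompactSpace W] in
/-- On the ray beyond `ρ₁` the field decreases `⟪e, f⟫`. [folklore] -/
theorem inner_mfderiv_neg_of_onRay {z : W} (hA : angleForm e (P.f z) = 0) (hR : ρ₁ ≤ ⟪e, P.f z⟫) :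
    ⟪e, mfderiv (𝓡∂ 4) 𝓘(ℝ, EuclideanSpace ℝ (Fin 2)) P.f z (D''.ξ z)⟫ < 0 := by
  have _ := hw₀; have _ := hang
  have hq : P.f z = ⟪e, P.f z⟫ • e := eq_inner_smul_of_angleForm_eq_zero he hA
  have hRpos : 0 < ⟪e, P.f z⟫ := lt_of_lt_of_le (hρ.trans hρρ₁) hR
  have hnorm : ρ'' ≤ ‖P.f z‖ := by
    rw [hq, norm_smul, he, mul_one, Real.norm_eq_abs]
    exact (hρ''ρ₁.le.trans hR).trans (le_abs_self _)
  have h := hrad z hnorm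
  rw [hq, real_inner_smul_left] at h
  rcases mul_neg_iff.1 h with h1 | h1
  · exact h1.2
  · exact absurd h1.1 (not_lt.2 hRpos.le)

omit [T2Space W] [CompactSpace W] in
/-- **The retraction lands on the ray**: for `x` over `ρ₁ e` with `σ x ≤ min(s₀, a)`,
`f (ret x) = ⟪e, f (ret x)⟫ e` with `⟪e, f (ret x)⟫ ≥ ρ₁`. [cite: Kas1980, §2] -/
theorem angleForm_ret_eq_zero_and_le {x : W} (hxs : D''.f x ≤ s₀) (hxa : D''.f x ≤ Γ.a)
    (hfx : P.f x = ρ₁ • e) :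
    angleForm e (P.f (Γ.ret x)) = 0 ∧ ρ₁ ≤ ⟪e, P.f (Γ.ret x)⟫ :=
  P.forall_angleForm_eq_zero_and_le_inner_Fl Γ he hρ hw₀ hρρ₁ hρ''ρ₁ hang hrad hxs hxa hfx
    (-D''.f x) ⟨le_rfl, by linarith [D''.f_nonneg x]⟩

omit [T2Space W] [CompactSpace W] in
/-- **The retraction lands in the page over `e`.** [cite: Kas1980, §2] -/
theorem inclInv_ret_mem_page [Nonempty b.carrier] {x : W} (hxs : D''.f x ≤ s₀) (hxa : D''.f x ≤ Γ.a)
    (hfx : P.f x = ρ₁ • e) :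
    b.inclInv (Γ.ret x) ∈ P.ob.page ⟨e, mem_sphere_zero_iff_norm.2 he⟩ := by
  obtain ⟨hA, hR⟩ := P.angleForm_ret_eq_zero_and_le Γ he hρ hw₀ hρρ₁ hρ''ρ₁ hang hrad hxs hxa hfx
  set y := b.inclInv (Γ.ret x) with hy
  have hiy : b.incl y = Γ.ret x := b.incl_inclInv (Γ.ret_mem_boundary hxa)
  set Rv : ℝ := ⟪e, P.f (Γ.ret x)⟫ with hRv
  have hRpos : 0 < Rv := lt_of_lt_of_le (hρ.trans hρρ₁) hR
  have hq : P.f (b.incl y) = Rv • e := by rw [hiy]; exact eq_inner_smul_of_angleForm_eq_zero he hA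
  have hne : P.f (b.incl y) ≠ 0 := by
    rw [hq]; exact smul_ne_zero hRpos.ne' (by rw [← norm_ne_zero_iff, he]; exact one_ne_zero)
  refine ⟨fun h => hne ((P.mem_binding_iff y).1 h), Subtype.ext ?_⟩
  rw [P.coe_proj_eq y hne, hq, norm_smul]
  show (‖Rv‖ * ‖e‖)⁻¹ • Rv • e = e
  rw [he, mul_one, Real.norm_eq_abs, abs_of_pos hRpos, smul_smul, inv_mul_cancel₀ hRpos.ne', one_smul]

omit [CompactSpace W] in
/-- **The retraction is injective on the fibre over the ray point** (both points lie on the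
forward flow line from their common retraction point, along which `⟪e, f⟫` is strictly
decreasing). [cite: Kas1980, §2] -/
theorem eq_of_ret_eq {x x' : W} (hxs : D''.f x ≤ s₀) (hxa : D''.f x ≤ Γ.a) (hfx : P.f x = ρ₁ • e)
    (hx's : D''.f x' ≤ s₀) (hx'a : D''.f x' ≤ Γ.a) (hfx' : P.f x' = ρ₁ • e)
    (hret : Γ.ret x = Γ.ret x') : x = x' := by
  -- reduce to `σ x ≤ σ x'`
  wlog hle : D''.f x ≤ D''.f x' generalizing x x'
  · exact (this hx's hx'a hfx' hxs hxa hfx hret.symm (le_of_not_ge hle)).symm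
  set z₀ := Γ.ret x with hz₀
  have hz₀σ : D''.f z₀ = 0 := Γ.f_ret hxa
  have hz₀a : D''.f z₀ ≤ Γ.a := by rw [hz₀σ]; exact Γ.a_pos.le
  set c : ℝ → W := Γ.Fl z₀ with hcdef
  have hc : IsMIntegralCurveOn c D''.ξ (Icc 0 Γ.a) := by
    have h := Γ.isMIntegralCurveOn_Fl hz₀a
    rw [hz₀σ, neg_zero] at h
    exact h
  have hinner : ⟪e, e⟫ = 1 := by rw [real_inner_self_eq_norm_sq, he, one_pow]
  -- the invariant along `c` on `[0, σ x']` (from `x'`) and the values at `σ x`, `σ x'`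
  have hcx : ∀ u ∈ Icc 0 (D''.f x), c u = Γ.Fl x (u - D''.f x) := fun u hu => Γ.Fl_ret_eq hxa hu
  have hcx' : ∀ u ∈ Icc 0 (D''.f x'), c u = Γ.Fl x' (u - D''.f x') := by
    intro u hu
    have h := Γ.Fl_ret_eq hx'a hu
    rw [← hret] at h
    exact h
  have hinv : ∀ u ∈ Icc 0 (D''.f x'),
      angleForm e (P.f (c u)) = 0 ∧ ρ₁ ≤ ⟪e, P.f (c u)⟫ := by
    intro u hu
    rw [hcx' u hu]
    exact P.forall_angleForm_eq_zero_and_le_inner_Fl Γ he hρ hw₀ hρρ₁ hρ''ρ₁ hang hrad hx's hx'a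
      hfx' (u - D''.f x') ⟨by linarith [hu.1], by linarith [hu.2]⟩
  have hcσx : c (D''.f x) = x := by
    rw [hcx _ ⟨D''.f_nonneg x, le_rfl⟩, sub_self, Γ.Fl_zero hxa]
  have hcσx' : c (D''.f x') = x' := by
    rw [hcx' _ ⟨D''.f_nonneg x', le_rfl⟩, sub_self, Γ.Fl_zero hx'a]
  -- `u ↦ ⟪e, f (c u)⟫` is strictly decreasing on `[0, σ x']`
  set Rf : ℝ → ℝ := fun u => ⟪e, P.f (c u)⟫ with hRf
  have hsub : Icc 0 (D''.f x') ⊆ Icc 0 Γ.a := Icc_subset_Icc le_rfl hx'a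
  have hfd : ∀ u ∈ Icc 0 Γ.a, HasDerivWithinAt (fun u => P.f (c u))
      (mfderiv (𝓡∂ 4) 𝓘(ℝ, EuclideanSpace ℝ (Fin 2)) P.f (c u) (D''.ξ (c u))) (Icc 0 Γ.a) u :=
    fun u hu => hasDerivWithinAt_comp_of_isMIntegralCurveOn P.contMDiff hc hu
  have hRd : ∀ u ∈ Icc 0 Γ.a, HasDerivWithinAt Rf
      ⟪e, mfderiv (𝓡∂ 4) 𝓘(ℝ, EuclideanSpace ℝ (Fin 2)) P.f (c u) (D''.ξ (c u))⟫ (Icc 0 Γ.a) u := by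
    intro u hu
    have h := (hasDerivWithinAt_const u (Icc 0 Γ.a) e).inner ℝ (hfd u hu)
    simpa using h
  have hRc : ContinuousOn Rf (Icc 0 (D''.f x')) := fun u hu => ((hRd u (hsub hu)).mono hsub).continuousWithinAt
  have hanti : StrictAntiOn Rf (Icc 0 (D''.f x')) := by
    refine strictAntiOn_of_hasDerivWithinAt_neg (convex_Icc _ _) hRc
      (fun u hu => (hRd u (hsub (interior_subset hu))).mono (interior_subset.trans hsub)) ?_
    intro u hu
    obtain ⟨hA, hR⟩ := hinv u (interior_subset hu)
    exact P.inner_mfderiv_neg_of_onRay he hρ hw₀ hρρ₁ hρ''ρ₁ hang hrad hA hR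
  have hR1 : Rf (D''.f x) = ρ₁ := by
    show ⟪e, P.f (c (D''.f x))⟫ = ρ₁
    rw [hcσx, hfx, real_inner_smul_right, hinner, mul_one]
  have hR2 : Rf (D''.f x') = ρ₁ := by
    show ⟪e, P.f (c (D''.f x'))⟫ = ρ₁
    rw [hcσx', hfx', real_inner_smul_right, hinner, mul_one]
  have hσeq : D''.f x = D''.f x' :=
    hanti.injOn ⟨D''.f_nonneg x, hle⟩ ⟨D''.f_nonneg x', le_rfl⟩ (hR1.trans hR2.symm)
  rw [← hcσx, ← hcσx', hσeq]

end Retraction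

/-! ### §4 Planar pages give planar fibres -/

/-- **The fibre over a ray point close to the boundary circle injects continuously into the page
over the ray** (Kas 1980, §2: near the vertical boundary the fibre is the page): for a unit
vector `e` there is a regular value `ρ₁ e`, `0 < ρ₁ < 1`, and a continuous injection of
`F°(ρ₁ e)` into `P.ob.page e` — the retraction of the angle-preserving flow-out data.
[cite: Kas1980, §2] [cite: GompfStipsiczGSM1999, §8.2] -/
theorem exists_continuous_injective_regularFibreOn_page (P : PALF o b) {e : EuclideanSpace ℝ (Fin 2)}
    (he : ‖e‖ = 1) :
    ∃ (ρ₁ : ℝ) (hreg : ρ₁ • e ∉ P.f '' ↑P.crit), 0 < ρ₁ ∧ ρ₁ < 1 ∧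
      ∃ g : RegularFibreOn (P.isRegularFibreOn_interior hreg) →
          P.ob.page ⟨e, mem_sphere_zero_iff_norm.2 he⟩,
        Continuous g ∧ Injective g := by
  haveI : Nonempty b.carrier := P.nonempty_carrier
  obtain ⟨D⟩ := (nonempty_flowoutInput : Nonempty (FlowoutInput 3 W))
  obtain ⟨D'', s₀, w₀, hs₀, hw₀, hfeq, hang0⟩ :=
    P.exists_flowoutInput_angleForm_eq_zero D he (ρ := 1 / 2) (by norm_num)
  have hang : ∀ x, D''.f x ≤ s₀ → 1 / 2 ≤ ⟪e, P.f x⟫ → |angleForm e (P.f x)| ≤ w₀ →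
      angleForm e (mfderiv (𝓡∂ 4) 𝓘(ℝ, EuclideanSpace ℝ (Fin 2)) P.f x (D''.ξ x)) = 0 :=
    fun x h1 h2 h3 => hang0 x (by rw [← hfeq]; exact h1) h2 h3
  obtain ⟨ρ'', hρ''1, hrad⟩ := P.exists_lt_one_forall_inner_mfderiv_neg D''
  obtain ⟨Γ⟩ := D''.nonempty_cover
  set s : ℝ := min s₀ (Γ.a / 2) with hs
  have hspos : 0 < s := lt_min hs₀ (by linarith [Γ.a_pos])
  obtain ⟨ρ', hρ'1, hρ'σ⟩ := P.exists_lt_one_forall_flowout_lt D'' hspos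
  set ρ₀ : ℝ := max (max (1 / 2) ρ'') ρ' with hρ₀
  have hρ₀1 : ρ₀ < 1 := max_lt (max_lt (by norm_num) hρ''1) hρ'1
  obtain ⟨ρ₁, hρ₀ρ₁, hρ₁1, hreg⟩ := P.exists_regular_smul_mem_Ioo he hρ₀1
  have h12 : (1 / 2 : ℝ) < ρ₁ := lt_of_le_of_lt ((le_max_left _ _).trans (le_max_left _ _)) hρ₀ρ₁
  have hρ''ρ₁ : ρ'' < ρ₁ := lt_of_le_of_lt ((le_max_right _ _).trans (le_max_left _ _)) hρ₀ρ₁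
  have hρ'ρ₁ : ρ' < ρ₁ := lt_of_le_of_lt (le_max_right _ _) hρ₀ρ₁
  have hρ₁pos : 0 < ρ₁ := by linarith
  set hF := P.isRegularFibreOn_interior hreg
  -- the points of the fibre
  have hfq : ∀ q : RegularFibreOn hF, P.f q.1 = ρ₁ • e := fun q => q.2.1
  have hσq : ∀ q : RegularFibreOn hF, D''.f q.1 < s := by
    intro q
    apply hρ'σ
    rw [hfq q, norm_smul, he, mul_one, Real.norm_eq_abs, abs_of_pos hρ₁pos]
    exact hρ'ρ₁.le
  have hσs₀ : ∀ q : RegularFibreOn hF, D''.f q.1 ≤ s₀ := fun q => (hσq q).le.trans (min_le_left _ _)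
  have hσa : ∀ q : RegularFibreOn hF, D''.f q.1 ≤ Γ.a := fun q =>
    ((hσq q).le.trans (min_le_right _ _)).trans (by linarith [Γ.a_pos])
  refine ⟨ρ₁, hreg, hρ₁pos, hρ₁1, fun q => ⟨b.inclInv (Γ.ret q.1),
    P.inclInv_ret_mem_page Γ he (by norm_num) hw₀ h12 hρ''ρ₁ hang hrad (hσs₀ q) (hσa q) (hfq q)⟩,
    ?_, ?_⟩
  · -- continuity
    set O := Γ.openCollarData b with hO
    have hcont : ContinuousOn O.proj O.region := O.contMDiffOn_proj.continuousOn
    have h1 : Continuous fun q : RegularFibreOn hF => O.proj q.1 := by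
      refine hcont.comp_continuous continuous_subtype_val fun q => ?_
      show D''.f q.1 < Γ.a
      exact lt_of_lt_of_le (hσq q) ((min_le_right _ _).trans (by linarith [Γ.a_pos]))
    exact h1.subtype_mk _
  · -- injectivity
    intro q q' hqq'
    have h1 : b.inclInv (Γ.ret q.1) = b.inclInv (Γ.ret q'.1) := congrArg Subtype.val hqq'
    have h2 : Γ.ret q.1 = Γ.ret q'.1 := by
      rw [← b.incl_inclInv (Γ.ret_mem_boundary (hσa q)), ← b.incl_inclInv (Γ.ret_mem_boundary (hσa q')), h1]
    exact Subtype.ext (P.eq_of_ret_eq Γ he (by norm_num) hw₀ h12 hρ''ρ₁ hang hrad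
      (hσs₀ q) (hσa q) (hfq q) (hσs₀ q') (hσa q') (hfq q') h2)

/-- **Planar boundary open book ⇒ planar regular fibres** (Kas 1980, §2; Gompf–Stipsicz 1999,
§8.2: the regular fibre of a PALF is the page of its boundary open book).  If every page of the
boundary open book injects continuously into the `2`-sphere, so does the interior `F°(c)` of
every regular fibre over the open disc: transport `F°(c)` to the fibre over a ray point near the
boundary circle (`PALF.nonempty_homeomorph_regularFibreOn`), inject it into the page over the
ray (`exists_continuous_injective_regularFibreOn_page`), then into the sphere.
[cite: Kas1980, §2] [cite: GompfStipsiczGSM1999, §8.2] -/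
theorem exists_continuous_injective_regularFibreOn_sphere (P : PALF o b) (hpl : P.ob.IsPlanar)
    {c : EuclideanSpace ℝ (Fin 2)} (hc1 : ‖c‖ < 1) (hc : c ∉ P.f '' ↑P.crit) :
    ∃ F : RegularFibreOn (P.isRegularFibreOn_interior hc) →
        Metric.sphere (0 : EuclideanSpace ℝ (Fin 3)) 1, Continuous F ∧ Injective F := by
  set e : EuclideanSpace ℝ (Fin 2) := !₂[(1 : ℝ), 0] with hedef
  have he : ‖e‖ = 1 := by
    rw [hedef, EuclideanSpace.norm_eq]
    simp [Fin.sum_univ_two]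
  obtain ⟨ρ₁, hreg, hρ₁0, hρ₁1, g, hgc, hgi⟩ := P.exists_continuous_injective_regularFibreOn_page he
  obtain ⟨ι, hιc, hιi⟩ := hpl ⟨e, mem_sphere_zero_iff_norm.2 he⟩
  have hn : ‖ρ₁ • e‖ < 1 := by
    rw [norm_smul, he, mul_one, Real.norm_eq_abs, abs_of_pos hρ₁0]; exact hρ₁1
  obtain ⟨h⟩ := P.nonempty_homeomorph_regularFibreOn hc1 hc hn hreg
  exact ⟨ι ∘ g ∘ h, hιc.comp (hgc.comp h.continuous), hιi.comp (hgi.comp h.injective)⟩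

end PALF

end Literature.Geometry.Symplectic

end
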